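import Mathlib
import HarnessLib
import Summits.KontsevichZagierPeriods.Zeta5Search.VWPSeriesSummable

/-!
# ζ(5) search — holomorphy of Zudilin's very-well-poised series `F_m` in the parameter `h₀` (cell `pub-zeta5`, ct-1 g28)

HONEST FRAMING: systematic search; no irrationality claim unless kernel-certified.  A holomorphy statement for a hypergeometric series
(Weierstrass M-test); nothing here is an irrationality result, a worthiness exponent or a denominator statement; no named fact is
discharged; no definition is introduced.

Brick B6d (F-side) of `HOME/ct-1/g28/VWP-BLUEPRINT-g28.md` §3 (g): general-`m` version of g26's `DougallComplexH0.differentiableOn_series_h0`.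
For fixed complex `h₁, …, h_m` with `Re h_i > 0`, the series `v ↦ Σ_μ (v+2μ)·[Γ(v+μ)/Γ(1+μ)]·∏_{i=1}^m Γ(h_i+μ)/Γ(1+v−h_i+μ)·(−1)^{(m+1)μ}`
(= `F_m(v; h₁, …, h_m)`, the `i = 0` factor separated) is complex-differentiable at every `v₀` with `Re v₀ > 0`, `Re h_i < 1 + Re v₀` and
(5) `2Σ Re h_i < (m−1)(1+Re v₀)`: M-test on a small ball with the majorant
`(R+2μ)·MΓ Γ(x_u+μ)/(Γ(x_u) μ!)·∏_i Γ(Re h_i+μ) M_i Γ(b_i)/Γ(b_i+μ) = O(μ^{E₀+(m+1)δ})`.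

* `norm_term_le` — the termwise bound at one point; `differentiableAt_term` — termwise holomorphy;
* **`differentiableAt_series_h0`**; `prod_update_zero` — the bridge to the `Function.update h 0 v` form of `S(n)`.

Theorems only; imports `Zeta5Search/VWPSeriesSummable`.
-/

noncomputable section

namespace Summit.KontsevichZagierPeriods.Zeta5Search.VWPSeriesHolomorphyH0

open Metric
open Literature.Analysis.SpecialFunctions.GammaVert (norm_Gamma_le_Gamma_re)
open Summit.KontsevichZagierPeriods.Zeta5Search.BarnesMellin (ne_neg_nat_of_re_pos)
open Summit.KontsevichZagierPeriods.Zeta5Search.DougallCoefficientBounds (Gamma_add_nat_eq)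
open Summit.KontsevichZagierPeriods.Zeta5Search.DougallParameterHolomorphy (norm_Gamma_add_nat_le)
open Summit.KontsevichZagierPeriods.Zeta5Search.DougallComplexParameters (norm_inv_Gamma_add_nat_le)
open Summit.KontsevichZagierPeriods.Zeta5Search.VWPSeriesSummable (norm_prod_Gamma_ratio_le)

/-! ### 1. Termwise bound and holomorphy -/

/-- **Termwise bound**: for `Re v > 0`, `Re(1+v−h_i) > 0` (`i ∈ Icc 1 m`),
`‖(v+2μ)(Γ(v+μ)/Γ(1+μ))∏_i Γ(h_i+μ)/Γ(1+v−h_i+μ)(−1)^{(m+1)μ}‖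
  ≤ (‖v‖+2μ)·(Γ(Re v)∏_{j<μ}(Re v+j)/μ!)·∏_i [Γ(Re h_i)∏_{j<μ}(Re h_i+j)·(‖Γ(1+v−h_i)⁻¹‖/∏_{j<μ}(Re(1+v−h_i)+j))]`. -/
theorem norm_term_le (m : ℕ) (h : ℕ → ℂ) (hpos : ∀ i ∈ Finset.Icc 1 m, 0 < (h i).re) {v : ℂ} (hv : 0 < v.re)
    (hb : ∀ i ∈ Finset.Icc 1 m, 0 < (1 + v - h i).re) (μ : ℕ) :
    ‖(v + 2 * μ) * (Complex.Gamma (v + μ) / Complex.Gamma (1 + μ) *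
        ∏ i ∈ Finset.Icc 1 m, Complex.Gamma (h i + μ) / Complex.Gamma (1 + v - h i + μ)) * (-1 : ℂ) ^ ((m + 1) * μ)‖ ≤
      (‖v‖ + 2 * μ) * (Real.Gamma v.re * (∏ j ∈ Finset.range μ, (v.re + j)) / μ.factorial) *
        ∏ i ∈ Finset.Icc 1 m, (Real.Gamma (h i).re * (∏ j ∈ Finset.range μ, ((h i).re + j)) *
          (‖(Complex.Gamma (1 + v - h i))⁻¹‖ / ∏ j ∈ Finset.range μ, ((1 + v - h i).re + j))) := by
  have n1 : ‖v + 2 * μ‖ ≤ ‖v‖ + 2 * μ := by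
    calc ‖v + 2 * μ‖ ≤ ‖v‖ + ‖(2 * μ : ℂ)‖ := norm_add_le _ _
      _ = ‖v‖ + 2 * μ := by
          rw [show (2 * μ : ℂ) = ((2 * μ : ℝ) : ℂ) by push_cast; ring, Complex.norm_real, Real.norm_of_nonneg (by positivity)]
  have n2 : ‖Complex.Gamma (v + μ) / Complex.Gamma (1 + μ)‖ ≤ Real.Gamma v.re * (∏ j ∈ Finset.range μ, (v.re + j)) / μ.factorial := by
    rw [norm_div, show (1 : ℂ) + μ = (μ : ℂ) + 1 by ring, Complex.Gamma_nat_eq_factorial, Complex.norm_natCast]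
    exact div_le_div_of_nonneg_right (norm_Gamma_add_nat_le hv μ) (by positivity)
  have n3 : ∀ i ∈ Finset.Icc 1 m, ‖Complex.Gamma (h i + μ) / Complex.Gamma (1 + v - h i + μ)‖ ≤
      Real.Gamma (h i).re * (∏ j ∈ Finset.range μ, ((h i).re + j)) *
        (‖(Complex.Gamma (1 + v - h i))⁻¹‖ / ∏ j ∈ Finset.range μ, ((1 + v - h i).re + j)) := by
    intro i hi
    rw [norm_div, div_eq_mul_inv, ← norm_inv]
    exact mul_le_mul (norm_Gamma_add_nat_le (hpos i hi) μ) (norm_inv_Gamma_add_nat_le (hb i hi) μ) (norm_nonneg _)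
      (mul_nonneg (Real.Gamma_pos_of_pos (hpos i hi)).le (Finset.prod_nonneg fun j _ => by linarith [hpos i hi, j.cast_nonneg (α := ℝ)]))
  rw [norm_mul, norm_mul, norm_mul, norm_pow, norm_neg, norm_one, one_pow, mul_one, norm_prod]
  have hB : 0 ≤ Real.Gamma v.re * (∏ j ∈ Finset.range μ, (v.re + j)) / μ.factorial := by
    have := Real.Gamma_pos_of_pos hv; positivity
  calc ‖v + 2 * μ‖ * (‖Complex.Gamma (v + μ) / Complex.Gamma (1 + μ)‖ *
        ∏ i ∈ Finset.Icc 1 m, ‖Complex.Gamma (h i + μ) / Complex.Gamma (1 + v - h i + μ)‖)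
      ≤ (‖v‖ + 2 * μ) * ((Real.Gamma v.re * (∏ j ∈ Finset.range μ, (v.re + j)) / μ.factorial) *
        ∏ i ∈ Finset.Icc 1 m, (Real.Gamma (h i).re * (∏ j ∈ Finset.range μ, ((h i).re + j)) *
          (‖(Complex.Gamma (1 + v - h i))⁻¹‖ / ∏ j ∈ Finset.range μ, ((1 + v - h i).re + j)))) :=
        mul_le_mul n1 (mul_le_mul n2 (Finset.prod_le_prod (fun _ _ => norm_nonneg _) n3)
          (Finset.prod_nonneg fun _ _ => norm_nonneg _) hB) (by positivity) (by positivity)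
    _ = _ := by ring

/-- Termwise holomorphy in `v` where `Re v > 0` and `Re(1+v−h_i) > 0`. -/
theorem differentiableAt_term (m : ℕ) (h : ℕ → ℂ) (μ : ℕ) {v : ℂ} (hv : 0 < v.re) (hb : ∀ i ∈ Finset.Icc 1 m, 0 < (1 + v - h i).re) :
    DifferentiableAt ℂ (fun v : ℂ => (v + 2 * μ) * (Complex.Gamma (v + μ) / Complex.Gamma (1 + μ) *
        ∏ i ∈ Finset.Icc 1 m, Complex.Gamma (h i + μ) / Complex.Gamma (1 + v - h i + μ)) * (-1 : ℂ) ^ ((m + 1) * μ)) v := by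
  have d0 : DifferentiableAt ℂ (fun v : ℂ => Complex.Gamma (v + μ)) v :=
    (Complex.differentiableAt_Gamma _ (ne_neg_nat_of_re_pos (by simp; positivity))).comp v (differentiableAt_id.add_const _)
  have dj : ∀ i ∈ Finset.Icc 1 m, DifferentiableAt ℂ (fun v : ℂ => Complex.Gamma (h i + μ) / Complex.Gamma (1 + v - h i + μ)) v := by
    intro i hi
    have hbi := hb i hi
    have hre : 0 < (1 + v - h i + (μ : ℂ)).re := by
      simp only [Complex.add_re, Complex.sub_re, Complex.one_re, Complex.natCast_re] at hbi ⊢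
      linarith [μ.cast_nonneg (α := ℝ)]
    refine (differentiableAt_const _).div ?_ (Complex.Gamma_ne_zero_of_re_pos hre)
    exact (Complex.differentiableAt_Gamma _ (ne_neg_nat_of_re_pos hre)).comp v
      ((((differentiableAt_const _).add differentiableAt_id).sub_const _).add_const _)
  refine DifferentiableAt.mul (DifferentiableAt.mul (differentiableAt_id.add_const _) ((d0.div_const _).mul ?_))
    (differentiableAt_const _)
  exact DifferentiableAt.fun_finsetProd (f := fun i v => Complex.Gamma (h i + μ) / Complex.Gamma (1 + v - h i + μ)) dj

/-! ### 2. The M-test -/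

set_option maxHeartbeats 400000 in
/-- **`F_m` is holomorphic in `h₀`**: for complex `h₁, …, h_m` with `Re h_i > 0` and `v₀` with `Re v₀ > 0`, `Re h_i < 1 + Re v₀` and
`2 Σ_{i=1}^m Re h_i < (m−1)(1 + Re v₀)` (Zudilin's (5) at `h₀ = v₀`), the very-well-poised series
`v ↦ Σ_μ (v+2μ)·[Γ(v+μ)/Γ(1+μ)]·∏_{i=1}^m Γ(h_i+μ)/Γ(1+v−h_i+μ)·(−1)^{(m+1)μ}` is complex-differentiable at `v₀`. -/
theorem differentiableAt_series_h0 (m : ℕ) (h : ℕ → ℂ) (hpos : ∀ i ∈ Finset.Icc 1 m, 0 < (h i).re) {v₀ : ℂ} (hv₀ : 0 < v₀.re)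
    (hden : ∀ i ∈ Finset.Icc 1 m, (h i).re < 1 + v₀.re)
    (h5 : 2 * (∑ i ∈ Finset.Icc 1 m, (h i).re) < ((m : ℝ) - 1) * (1 + v₀.re)) :
    DifferentiableAt ℂ (fun v : ℂ => ∑' μ : ℕ, (v + 2 * μ) * (Complex.Gamma (v + μ) / Complex.Gamma (1 + μ) *
        ∏ i ∈ Finset.Icc 1 m, Complex.Gamma (h i + μ) / Complex.Gamma (1 + v - h i + μ)) * (-1 : ℂ) ^ ((m + 1) * μ)) v₀ := by
  -- the room `δ`
  have hdpos : ∀ i ∈ Finset.Icc 1 m, 0 < 1 + v₀.re - (h i).re := fun i hi => by linarith [hden i hi]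
  set G : ℝ := ((m : ℝ) - 1) * (1 + v₀.re) - 2 * ∑ i ∈ Finset.Icc 1 m, (h i).re with hG
  have hG0 : 0 < G := by rw [hG]; linarith
  set δ : ℝ := min (min (v₀.re / 2) (G / (2 * (m + 2)))) (2 * (1 + ∑ i ∈ Finset.Icc 1 m, (1 + v₀.re - (h i).re)⁻¹))⁻¹ with hδ
  have hδpos : 0 < δ := by
    rw [hδ]
    refine lt_min (lt_min (by linarith) (by positivity)) ?_
    have : 0 ≤ ∑ i ∈ Finset.Icc 1 m, (1 + v₀.re - (h i).re)⁻¹ := Finset.sum_nonneg fun i hi => (inv_pos.2 (hdpos i hi)).le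
    positivity
  have hδ1 : δ ≤ v₀.re / 2 := le_trans (min_le_left _ _) (min_le_left _ _)
  have hδ2 : δ ≤ G / (2 * (m + 2)) := le_trans (min_le_left _ _) (min_le_right _ _)
  have hδ3 : ∀ i ∈ Finset.Icc 1 m, δ ≤ (1 + v₀.re - (h i).re) / 2 := by
    intro i hi
    have hs : (1 + v₀.re - (h i).re)⁻¹ ≤ ∑ j ∈ Finset.Icc 1 m, (1 + v₀.re - (h j).re)⁻¹ :=
      Finset.single_le_sum (f := fun j => (1 + v₀.re - (h j).re)⁻¹) (fun j hj => (inv_pos.2 (hdpos j hj)).le) hi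
    have hd := hdpos i hi
    calc δ ≤ (2 * (1 + ∑ j ∈ Finset.Icc 1 m, (1 + v₀.re - (h j).re)⁻¹))⁻¹ := min_le_right _ _
      _ ≤ (2 * (1 + v₀.re - (h i).re)⁻¹)⁻¹ := by
          apply inv_anti₀ (by positivity)
          linarith
      _ = (1 + v₀.re - (h i).re) / 2 := by rw [mul_inv, inv_inv]; ring
  set xl : ℝ := v₀.re - δ with hxl
  set xu : ℝ := v₀.re + δ with hxu
  have hxl0 : 0 < xl := by rw [hxl]; linarith
  set bl : ℕ → ℝ := fun i => 1 + xl - (h i).re with hbl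
  have hbl0 : ∀ i ∈ Finset.Icc 1 m, 0 < bl i := fun i hi => by simp only [hbl, hxl]; linarith [hδ3 i hi, hdpos i hi]
  -- points of the ball
  have hre : ∀ v ∈ ball v₀ δ, xl < v.re ∧ v.re < xu := by
    intro v hv
    rw [mem_ball, dist_eq_norm] at hv
    have h1 := Complex.abs_re_le_norm (v - v₀)
    simp only [Complex.sub_re] at h1
    have h2 := abs_lt.1 (lt_of_le_of_lt h1 hv)
    exact ⟨by rw [hxl]; linarith [h2.1], by rw [hxu]; linarith [h2.2]⟩
  set R : ℝ := ‖v₀‖ + δ with hR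
  have hnorm : ∀ v ∈ ball v₀ δ, ‖v‖ ≤ R := by
    intro v hv
    rw [mem_ball, dist_eq_norm] at hv
    have := norm_le_norm_add_norm_sub' v v₀
    rw [hR]; linarith
  -- `Γ` on `[xl, xu]`
  obtain ⟨MΓ, hMΓ⟩ : ∃ M : ℝ, ∀ x ∈ Set.Icc xl xu, Real.Gamma x ≤ M := by
    have hc : ContinuousOn Real.Gamma (Set.Icc xl xu) := fun x hx =>
      (Real.differentiableAt_Gamma fun n => by
        have : 0 < x := lt_of_lt_of_le hxl0 hx.1
        intro h0; rw [h0] at this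
        have := n.cast_nonneg (α := ℝ); linarith).continuousAt.continuousWithinAt
    obtain ⟨M, hM⟩ := isCompact_Icc.exists_bound_of_continuousOn hc
    exact ⟨M, fun x hx => (le_abs_self _).trans (by simpa [Real.norm_eq_abs] using hM x hx)⟩
  have hMΓ0 : 0 ≤ MΓ := (Real.Gamma_pos_of_pos hv₀).le.trans (hMΓ v₀.re ⟨by rw [hxl]; linarith, by rw [hxu]; linarith⟩)
  -- `‖Γ(1+v−h_i)⁻¹‖` on the closed ball
  have hMj : ∀ i : ℕ, ∃ M : ℝ, 0 ≤ M ∧ ∀ v ∈ closedBall v₀ δ, ‖(Complex.Gamma (1 + v - h i))⁻¹‖ ≤ M := by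
    intro i
    have hc : Continuous fun v : ℂ => (Complex.Gamma (1 + v - h i))⁻¹ :=
      (Complex.differentiable_one_div_Gamma.comp (by fun_prop : Differentiable ℂ fun v : ℂ => 1 + v - h i)).continuous
    obtain ⟨M, hM⟩ := (isCompact_closedBall v₀ δ).exists_bound_of_continuousOn hc.continuousOn
    exact ⟨M, (norm_nonneg _).trans (hM v₀ (mem_closedBall_self hδpos.le)), hM⟩
  choose M hM0 hM using hMj
  -- the majorant
  set K : ℝ := MΓ / Real.Gamma xu * ∏ i ∈ Finset.Icc 1 m, (M i * Real.Gamma (bl i)) with hK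
  set u : ℕ → ℝ := fun μ => K * ((R + 2 * μ) * (Real.Gamma (xu + μ) / μ.factorial) *
    ∏ i ∈ Finset.Icc 1 m, (Real.Gamma ((h i).re + μ) / Real.Gamma (bl i + μ))) with hu
  have hxu0 : 0 < xu := by rw [hxu]; linarith
  have hK0 : 0 ≤ K := by
    rw [hK]
    exact mul_nonneg (div_nonneg hMΓ0 (Real.Gamma_pos_of_pos hxu0).le)
      (Finset.prod_nonneg fun i hi => mul_nonneg (hM0 i) (Real.Gamma_pos_of_pos (hbl0 i hi)).le)
  -- summability of the majorant
  have hsum : Summable u := by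
    -- the Gamma ratios as norms of complex ratios at real points
    obtain ⟨C, hC, hP⟩ := norm_prod_Gamma_ratio_le (insert 0 (Finset.Icc 1 m)) (fun i => if i = 0 then (xu : ℂ) else ((h i).re : ℂ))
      (fun i => if i = 0 then (1 : ℂ) else (bl i : ℂ))
      (fun i hi => by
        rcases Finset.mem_insert.1 hi with rfl | hi
        · simpa using hxu0
        · have : i ≠ 0 := by have := (Finset.mem_Icc.1 hi).1; omega
          simpa [this] using hpos i hi)
      (fun i hi => by
        rcases Finset.mem_insert.1 hi with rfl | hi
        · simp
        · have : i ≠ 0 := by have := (Finset.mem_Icc.1 hi).1; omega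
          simpa [this] using hbl0 i hi)
    set E : ℝ := 1 + ((xu - 1) + ∑ i ∈ Finset.Icc 1 m, ((h i).re - bl i)) with hE
    have hE1 : E < -1 := by
      have hs : ∑ i ∈ Finset.Icc 1 m, ((h i).re - bl i) = 2 * (∑ i ∈ Finset.Icc 1 m, (h i).re) - (m : ℝ) * (1 + xl) := by
        simp only [hbl, Finset.sum_sub_distrib, Finset.sum_const, Nat.card_Icc, nsmul_eq_mul]
        push_cast
        ring
      rw [hE, hs, hxu, hxl]
      have hm : (0 : ℝ) ≤ m := m.cast_nonneg
      have h3 : ((m : ℝ) + 2) * δ ≤ G / 2 := by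
        have := hδ2; rw [le_div_iff₀ (by positivity)] at this; linarith
      nlinarith
    have hg : Summable fun μ : ℕ => K * ((R + 2) * C) * (μ : ℝ) ^ E := (Real.summable_nat_rpow.2 hE1).mul_left _
    refine Summable.of_norm_bounded_eventually_nat hg ?_
    rw [Filter.eventually_atTop]
    refine ⟨⌈1 + xu + ∑ i ∈ Finset.Icc 1 m, (h i).re⌉₊, fun μ hμ => ?_⟩
    have hμR : 1 + xu + ∑ i ∈ Finset.Icc 1 m, (h i).re ≤ (μ : ℝ) := le_trans (Nat.le_ceil _) (by exact_mod_cast hμ)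
    have hsum0 : 0 ≤ ∑ i ∈ Finset.Icc 1 m, (h i).re := Finset.sum_nonneg fun i hi => (hpos i hi).le
    have hμ1 : 1 ≤ (μ : ℝ) := by linarith
    have hμ0 : 0 < (μ : ℝ) := by linarith
    have hζ : ∀ j ∈ insert 0 (Finset.Icc 1 m), ((fun i => if i = 0 then (xu : ℂ) else ((h i).re : ℂ)) j).re ≤ (μ : ℝ) := by
      intro j hj
      rcases Finset.mem_insert.1 hj with rfl | hj
      · simp; linarith
      · have hj0 : j ≠ 0 := by have := (Finset.mem_Icc.1 hj).1; omega
        have := Finset.single_le_sum (f := fun i => (h i).re) (fun i hi => (hpos i hi).le) hj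
        simp [hj0]; linarith
    have hPμ := hP μ hμ1 hζ
    rw [Finset.prod_insert (by simp), Finset.sum_insert (by simp)] at hPμ
    simp only [↓reduceIte] at hPμ
    -- identify the real ratios
    have r0 : ‖Complex.Gamma ((xu : ℂ) + μ) / Complex.Gamma (1 + μ)‖ = Real.Gamma (xu + μ) / μ.factorial := by
      rw [norm_div, show (xu : ℂ) + μ = ((xu + μ : ℝ) : ℂ) by push_cast; ring, Complex.Gamma_ofReal, Complex.norm_real,
        Real.norm_of_nonneg (Real.Gamma_pos_of_pos (by positivity)).le,
        show (1 : ℂ) + μ = (μ : ℂ) + 1 by ring, Complex.Gamma_nat_eq_factorial, Complex.norm_natCast]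
    have rj : ∀ i ∈ Finset.Icc 1 m, ‖Complex.Gamma ((((h i).re : ℝ) : ℂ) + μ) / Complex.Gamma (((bl i : ℝ) : ℂ) + μ)‖ =
        Real.Gamma ((h i).re + μ) / Real.Gamma (bl i + μ) := by
      intro i hi
      rw [norm_div, show (((h i).re : ℝ) : ℂ) + μ = (((h i).re + μ : ℝ) : ℂ) by push_cast; ring,
        show ((bl i : ℝ) : ℂ) + μ = ((bl i + μ : ℝ) : ℂ) by push_cast; ring, Complex.Gamma_ofReal, Complex.Gamma_ofReal,
        Complex.norm_real, Complex.norm_real, Real.norm_of_nonneg (Real.Gamma_pos_of_pos (by linarith [hpos i hi])).le,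
        Real.norm_of_nonneg (Real.Gamma_pos_of_pos (by linarith [hbl0 i hi])).le]
    have hprod : ∏ i ∈ Finset.Icc 1 m, ‖Complex.Gamma ((fun i => if i = 0 then (xu : ℂ) else ((h i).re : ℂ)) i + μ) /
        Complex.Gamma ((fun i => if i = 0 then (1 : ℂ) else (bl i : ℂ)) i + μ)‖ =
        ∏ i ∈ Finset.Icc 1 m, (Real.Gamma ((h i).re + μ) / Real.Gamma (bl i + μ)) := by
      refine Finset.prod_congr rfl fun i hi => ?_
      have hi0 : i ≠ 0 := by have := (Finset.mem_Icc.1 hi).1; omega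
      simp only [hi0, ↓reduceIte]
      exact rj i hi
    have hexp : (∑ x ∈ Finset.Icc 1 m, (((if x = 0 then (xu : ℂ) else (((h x).re : ℝ) : ℂ))).re -
        ((if x = 0 then (1 : ℂ) else ((bl x : ℝ) : ℂ))).re)) = ∑ i ∈ Finset.Icc 1 m, ((h i).re - bl i) := by
      refine Finset.sum_congr rfl fun i hi => ?_
      have hi0 : i ≠ 0 := by have := (Finset.mem_Icc.1 hi).1; omega
      simp [hi0]
    rw [hprod, r0, hexp] at hPμ
    simp only [Complex.ofReal_re, Complex.one_re] at hPμ
    have hR0 : 0 ≤ R := by rw [hR]; positivity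
    have hu0 : 0 ≤ u μ := by
      simp only [hu]
      refine mul_nonneg hK0 (mul_nonneg (mul_nonneg (by positivity) ?_) (Finset.prod_nonneg fun i hi => ?_))
      · exact div_nonneg (Real.Gamma_pos_of_pos (by positivity)).le (by positivity)
      · exact div_nonneg (Real.Gamma_pos_of_pos (by linarith [hpos i hi])).le (Real.Gamma_pos_of_pos (by linarith [hbl0 i hi])).le
    rw [Real.norm_of_nonneg hu0, hu]
    simp only
    have hlin : R + 2 * (μ : ℝ) ≤ (R + 2) * (μ : ℝ) ^ (1 : ℝ) := by
      rw [Real.rpow_one]; nlinarith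
    have hP0 : 0 ≤ Real.Gamma (xu + μ) / μ.factorial * ∏ i ∈ Finset.Icc 1 m, (Real.Gamma ((h i).re + μ) / Real.Gamma (bl i + μ)) :=
      mul_nonneg (div_nonneg (Real.Gamma_pos_of_pos (by positivity)).le (by positivity))
        (Finset.prod_nonneg fun i hi => div_nonneg (Real.Gamma_pos_of_pos (by linarith [hpos i hi])).le
          (Real.Gamma_pos_of_pos (by linarith [hbl0 i hi])).le)
    have hsplit : (μ : ℝ) ^ E = (μ : ℝ) ^ (1 : ℝ) * (μ : ℝ) ^ ((xu - 1) + ∑ i ∈ Finset.Icc 1 m, ((h i).re - bl i)) := by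
      rw [hE, Real.rpow_add hμ0]
    calc K * ((R + 2 * μ) * (Real.Gamma (xu + μ) / μ.factorial) * ∏ i ∈ Finset.Icc 1 m, (Real.Gamma ((h i).re + μ) / Real.Gamma (bl i + μ)))
        = K * ((R + 2 * μ) * ((Real.Gamma (xu + μ) / μ.factorial) *
            ∏ i ∈ Finset.Icc 1 m, (Real.Gamma ((h i).re + μ) / Real.Gamma (bl i + μ)))) := by ring
      _ ≤ K * (((R + 2) * (μ : ℝ) ^ (1 : ℝ)) * (C * (μ : ℝ) ^ ((xu - 1) + ∑ i ∈ Finset.Icc 1 m, ((h i).re - bl i)))) :=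
          mul_le_mul_of_nonneg_left (mul_le_mul hlin hPμ hP0 (by positivity)) hK0
      _ = K * ((R + 2) * C) * (μ : ℝ) ^ E := by rw [hsplit]; ring
  -- the M-test on the ball
  have hdiff : DifferentiableOn ℂ (fun v : ℂ => ∑' μ : ℕ, (v + 2 * μ) * (Complex.Gamma (v + μ) / Complex.Gamma (1 + μ) *
        ∏ i ∈ Finset.Icc 1 m, Complex.Gamma (h i + μ) / Complex.Gamma (1 + v - h i + μ)) * (-1 : ℂ) ^ ((m + 1) * μ)) (ball v₀ δ) := by
    refine Complex.differentiableOn_tsum_of_summable_norm hsum (fun μ v hv => ?_) isOpen_ball (fun μ v hv => ?_)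
    · obtain ⟨h1, h2⟩ := hre v hv
      exact (differentiableAt_term m h μ (by linarith) fun i hi => by
        have := hbl0 i hi; simp only [hbl] at this; simp; linarith).differentiableWithinAt
    · obtain ⟨h1, h2⟩ := hre v hv
      have hvpos : 0 < v.re := by linarith
      have hbv : ∀ i ∈ Finset.Icc 1 m, 0 < (1 + v - h i).re := fun i hi => by
        have := hbl0 i hi; simp only [hbl] at this; simp; linarith
      refine (norm_term_le m h hpos hvpos hbv μ).trans ?_
      -- compare factor by factor
      have f1 : ‖v‖ + 2 * μ ≤ R + 2 * μ := by linarith [hnorm v hv]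
      have f2 : Real.Gamma v.re * (∏ j ∈ Finset.range μ, (v.re + j)) / μ.factorial ≤ MΓ / Real.Gamma xu * (Real.Gamma (xu + μ) / μ.factorial) := by
        rw [Gamma_add_nat_eq xu hxu0 μ]
        have hp : ∏ j ∈ Finset.range μ, (v.re + j) ≤ ∏ j ∈ Finset.range μ, (xu + j) :=
          Finset.prod_le_prod (fun j _ => by positivity) fun j _ => by linarith
        have hΓxu : 0 < Real.Gamma xu := Real.Gamma_pos_of_pos hxu0
        calc Real.Gamma v.re * (∏ j ∈ Finset.range μ, (v.re + j)) / μ.factorial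
            ≤ MΓ * (∏ j ∈ Finset.range μ, (xu + j)) / μ.factorial :=
              div_le_div_of_nonneg_right (mul_le_mul (hMΓ v.re ⟨h1.le, h2.le⟩) hp
                (Finset.prod_nonneg fun j _ => by positivity) hMΓ0) (by positivity)
          _ = MΓ / Real.Gamma xu * (Real.Gamma xu * (∏ j ∈ Finset.range μ, (xu + j)) / μ.factorial) := by field_simp
      have f3 : ∀ i ∈ Finset.Icc 1 m, Real.Gamma (h i).re * (∏ j ∈ Finset.range μ, ((h i).re + j)) *
          (‖(Complex.Gamma (1 + v - h i))⁻¹‖ / ∏ j ∈ Finset.range μ, ((1 + v - h i).re + j)) ≤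
          (M i * Real.Gamma (bl i)) * (Real.Gamma ((h i).re + μ) / Real.Gamma (bl i + μ)) := by
        intro i hi
        have hb0 := hbl0 i hi
        rw [← Gamma_add_nat_eq (h i).re (hpos i hi) μ, Gamma_add_nat_eq (bl i) hb0 μ]
        have hP : ∏ j ∈ Finset.range μ, (bl i + j) ≤ ∏ j ∈ Finset.range μ, ((1 + v - h i).re + j) :=
          Finset.prod_le_prod (fun j _ => by linarith [j.cast_nonneg (α := ℝ)]) fun j _ => by
            simp only [hbl] ; simp; linarith
        have hP0 : 0 < ∏ j ∈ Finset.range μ, (bl i + j) := Finset.prod_pos fun j _ => by linarith [j.cast_nonneg (α := ℝ)]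
        have hΓb : 0 < Real.Gamma (bl i) := Real.Gamma_pos_of_pos hb0
        have hΓh : 0 ≤ Real.Gamma ((h i).re + μ) := (Real.Gamma_pos_of_pos (by linarith [hpos i hi])).le
        calc Real.Gamma ((h i).re + μ) * (‖(Complex.Gamma (1 + v - h i))⁻¹‖ / ∏ j ∈ Finset.range μ, ((1 + v - h i).re + j))
            ≤ Real.Gamma ((h i).re + μ) * (M i / ∏ j ∈ Finset.range μ, (bl i + j)) :=
              mul_le_mul_of_nonneg_left (div_le_div₀ (hM0 i) (hM i v (ball_subset_closedBall hv)) hP0 hP) hΓh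
          _ = M i * Real.Gamma (bl i) * (Real.Gamma ((h i).re + μ) / (Real.Gamma (bl i) * ∏ j ∈ Finset.range μ, (bl i + j))) := by
              field_simp
      have hfac0 : ∀ i ∈ Finset.Icc 1 m, 0 ≤ Real.Gamma (h i).re * (∏ j ∈ Finset.range μ, ((h i).re + j)) *
          (‖(Complex.Gamma (1 + v - h i))⁻¹‖ / ∏ j ∈ Finset.range μ, ((1 + v - h i).re + j)) := by
        intro i hi
        have hb' := hbv i hi
        have hp' := hpos i hi
        refine mul_nonneg (mul_nonneg (Real.Gamma_pos_of_pos hp').le (Finset.prod_nonneg fun j _ => by positivity))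
          (div_nonneg (norm_nonneg _) (Finset.prod_nonneg fun j _ => by positivity))
      have f3' := (Finset.prod_le_prod hfac0 f3).trans (le_of_eq Finset.prod_mul_distrib)
      have hR0' : 0 ≤ R := by rw [hR]; positivity
      have hA0 : 0 ≤ R + 2 * (μ : ℝ) := by positivity
      have hB0 : 0 ≤ Real.Gamma v.re * (∏ j ∈ Finset.range μ, (v.re + j)) / μ.factorial := by
        have := Real.Gamma_pos_of_pos hvpos; positivity
      have hB'0 : 0 ≤ MΓ / Real.Gamma xu * (Real.Gamma (xu + μ) / μ.factorial) := by
        have := Real.Gamma_pos_of_pos hxu0; have := Real.Gamma_pos_of_pos (show 0 < xu + μ by positivity); positivity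
      calc (‖v‖ + 2 * μ) * (Real.Gamma v.re * (∏ j ∈ Finset.range μ, (v.re + j)) / μ.factorial) *
            ∏ i ∈ Finset.Icc 1 m, (Real.Gamma (h i).re * (∏ j ∈ Finset.range μ, ((h i).re + j)) *
              (‖(Complex.Gamma (1 + v - h i))⁻¹‖ / ∏ j ∈ Finset.range μ, ((1 + v - h i).re + j)))
          ≤ (R + 2 * μ) * (MΓ / Real.Gamma xu * (Real.Gamma (xu + μ) / μ.factorial)) *
            ((∏ i ∈ Finset.Icc 1 m, (M i * Real.Gamma (bl i))) * ∏ i ∈ Finset.Icc 1 m, (Real.Gamma ((h i).re + μ) / Real.Gamma (bl i + μ))) :=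
            mul_le_mul (mul_le_mul f1 f2 hB0 hA0) f3' (Finset.prod_nonneg hfac0) (mul_nonneg hA0 hB'0)
        _ = u μ := by simp only [hu, hK]; ring
  exact hdiff.differentiableAt (isOpen_ball.mem_nhds (mem_ball_self hδpos))

/-! ### 3. The bridge to the `Function.update` form -/

/-- With `h' = Function.update h 0 v`: `∏_{i<m+1} Γ(h'_i+μ)/Γ(1+h'₀−h'_i+μ) = [Γ(v+μ)/Γ(1+μ)] · ∏_{i∈Icc 1 m} Γ(h_i+μ)/Γ(1+v−h_i+μ)`. -/
theorem prod_update_zero (m : ℕ) (h : ℕ → ℂ) (v : ℂ) (μ : ℕ) :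
    ∏ i ∈ Finset.range (m + 1), Complex.Gamma (Function.update h 0 v i + μ) /
        Complex.Gamma (1 + Function.update h 0 v 0 - Function.update h 0 v i + μ) =
      Complex.Gamma (v + μ) / Complex.Gamma (1 + μ) * ∏ i ∈ Finset.Icc 1 m, Complex.Gamma (h i + μ) / Complex.Gamma (1 + v - h i + μ) := by
  have hset : Finset.range (m + 1) = insert (0 : ℕ) (Finset.Icc 1 m) := by ext i; simp; omega
  rw [hset, Finset.prod_insert (by simp)]
  simp only [Function.update_self, add_sub_cancel_right]
  refine congrArg (fun z => Complex.Gamma (v + μ) / Complex.Gamma (1 + μ) * z) (Finset.prod_congr rfl fun i hi => ?_)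
  have hi0 : i ≠ 0 := by have := (Finset.mem_Icc.1 hi).1; omega
  rw [Function.update_of_ne hi0]

end Summit.KontsevichZagierPeriods.Zeta5Search.VWPSeriesHolomorphyH0

end
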